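/-
Copyright: pub-hodgecm mc cell (axioms-2 lane). [folklore] throughout.
-/
import Mathlib.Analysis.Complex.Basic
import Mathlib.Topology.Algebra.Group.Basic
import Mathlib.Topology.Algebra.ClopenNhdofOne
import Literature.NumberTheory.GaloisRepresentations.HeckeCharacterRamificationProofs

/-!
# A continuous character of a product group is trivial on all but finitely many factors

[folklore]  Elementary topological group theory, recorded for the consumers of
`Literature.NumberTheory.GelbartRogawski1991.SplittingDatum.CompatibleSplitting`
([GelbartRogawski1991, Prop. 3.1.1]: a CONTINUOUS compatible splitting `s : G(𝐀) → Mp_𝐀(W)`):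
the "almost everywhere unramified" behaviour of such an `s` on a product of compact open
subgroups `∏_{v ∉ S} K_v` is read off from continuity alone, through the character
`c = s · α⁻¹ : ∏ K_v → ker π = ℂ*` comparing `s` with the lattice-normalised implementers `α`.
The abstract input is this file:

* `IsNSSNhd U` — `U` is a neighbourhood of `1` in a topological group `M` containing no subgroup
  other than `⊥` ("no small subgroups inside `U`");
* `trivialOn S` — the subgroup of `Π i, K i` of families equal to `1` at every index of `S`;
* `exists_finset_trivialOn_le_ker` — a continuous homomorphism `c : (Π i, K i) →* M` into a group
  with such a `U` kills `trivialOn S` for some FINITE `S` (no compactness needed: `c ⁻¹' U` is a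
  neighbourhood of `1`, hence contains a cylinder `{k | ∀ i ∈ S, k i ∈ t i}` over a finite `S`,
  which contains the subgroup `trivialOn S`, whose image is a subgroup inside `U`);
* `isNSSNhd_units_complex` — `ℂˣ` has such a neighbourhood (`‖z - 1‖ < 1/2`, by
  `HeckeCharacter.eq_one_of_norm_pow_sub_one_le`), and the packaged corollaries
  `exists_finset_forall_apply_eq_one` / `exists_finset_forall_mulSingle_eq_one` for `ℂˣ`-valued
  continuous characters;
* `exists_openNormalSubgroup_le_ker` / `isOpen_ker_of_isNSSNhd` (section `Profinite`) — for a
  profinite (compact, totally disconnected) topological group `G`, a continuous `c : G →* M` into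
  a group with such a `U` has OPEN kernel, containing an open normal subgroup (via Mathlib's
  `ProfiniteGrp.exist_openNormalSubgroup_sub_open_nhds_of_one`); packaged for `ℂˣ` as
  `isOpen_ker_units_complex` / `exists_openNormalSubgroup_forall_eq_one` — the "open stabiliser"
  form;
* `twistHom` — the quotient `s · α⁻¹ : K →* Mp` of two lifts of one homomorphism through a
  `π : Mp →* Sp` with central kernel (`map_twistHom`, `eq_twistHom_mul`, `eq_of_twistHom_eq_one`):
  the character to which the above is applied; and conversely `mulCentralHom` — the product
  `s · ν` with a central-valued `ν` is again a homomorphism, with `π ∘ (s · ν) = π ∘ s` when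
  `π ∘ ν = 1` and `(s · ν)(k) = s(k)` wherever `ν(k) = 1`.

Nothing here is specific to adeles, theta series or the Hodge conjecture; no named facts.
-/

namespace Literature.GroupTheory.PiCharacter

open Topology Filter

universe u v w

section General

variable {ι : Type u} {K : ι → Type v} [∀ i, Group (K i)] {M : Type w} [Group M]
  [TopologicalSpace M]

/-- `U` is a neighbourhood of the identity containing no subgroup except the trivial one.
[folklore] -/
def IsNSSNhd (U : Set M) : Prop :=
  U ∈ 𝓝 (1 : M) ∧ ∀ H : Subgroup M, (H : Set M) ⊆ U → H = ⊥

variable (K) in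
/-- the subgroup of `Π i, K i` of families trivial at every index of `S`. [folklore] -/
def trivialOn (S : Set ι) : Subgroup (Π i, K i) where
  carrier := {k | ∀ i ∈ S, k i = 1}
  mul_mem' := by
    intro a b ha hb i hi
    rw [Pi.mul_apply, ha i hi, hb i hi, mul_one]
  one_mem' := by
    intro i _
    rfl
  inv_mem' := by
    intro a ha i hi
    rw [Pi.inv_apply, ha i hi, inv_one]

/-- membership in `trivialOn`. [folklore] -/
@[simp] theorem mem_trivialOn {S : Set ι} {k : Π i, K i} :
    k ∈ trivialOn K S ↔ ∀ i ∈ S, k i = 1 := Iff.rfl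

/-- `trivialOn` is antitone in the index set. [folklore] -/
theorem trivialOn_mono {S T : Set ι} (h : S ⊆ T) : trivialOn K T ≤ trivialOn K S :=
  fun _ hk i hi => hk i (h hi)

variable [∀ i, TopologicalSpace (K i)]

/-- **A continuous homomorphism out of a product group into a group with a subgroup-free
neighbourhood of `1` is trivial on `trivialOn S` for some finite `S`.** [folklore] -/
theorem exists_finset_trivialOn_le_ker {U : Set M} (hU : IsNSSNhd U) (c : (Π i, K i) →* M)
    (hc : Continuous c) : ∃ S : Finset ι, trivialOn K (↑S : Set ι) ≤ c.ker := by
  have h1 : c ⁻¹' U ∈ 𝓝 (1 : Π i, K i) := by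
    apply hc.continuousAt.preimage_mem_nhds
    rw [map_one]
    exact hU.1
  rw [nhds_pi, Filter.mem_pi] at h1
  obtain ⟨I, hI, t, ht, hsub⟩ := h1
  refine ⟨hI.toFinset, ?_⟩
  have hle : ((trivialOn K (↑hI.toFinset : Set ι) : Subgroup (Π i, K i)) : Set (Π i, K i)) ⊆
      c ⁻¹' U := by
    intro k hk
    apply hsub
    intro i hi
    have hki : k i = 1 := hk i (by simpa using hi)
    rw [hki]
    exact mem_of_mem_nhds (ht i)
  have hbot : (trivialOn K (↑hI.toFinset : Set ι)).map c = ⊥ := by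
    apply hU.2
    rintro _ ⟨k, hk, rfl⟩
    exact hle hk
  intro k hk
  rw [MonoidHom.mem_ker]
  have : c k ∈ (trivialOn K (↑hI.toFinset : Set ι)).map c := ⟨k, hk, rfl⟩
  rw [hbot] at this
  exact (Subgroup.mem_bot.mp this)

/-- pointwise form. [folklore] -/
theorem exists_finset_forall_apply_eq_one_of_isNSSNhd {U : Set M} (hU : IsNSSNhd U)
    (c : (Π i, K i) →* M) (hc : Continuous c) :
    ∃ S : Finset ι, ∀ k : Π i, K i, (∀ i ∈ S, k i = 1) → c k = 1 := by
  obtain ⟨S, hS⟩ := exists_finset_trivialOn_le_ker hU c hc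
  exact ⟨S, fun k hk => (MonoidHom.mem_ker).mp (hS (fun i hi => hk i hi))⟩

end General

section Profinite

/-! ### Continuous homomorphisms out of a profinite group have open kernel

[folklore]  For a compact totally disconnected topological group `G` (e.g. a compact open subgroup
`∏_v K_v(m_v)` of the finite-adelic points of a reductive group) every neighbourhood of `1`
contains an open subgroup (Mathlib `ProfiniteGrp.exist_openNormalSubgroup_sub_open_nhds_of_one`);
hence a continuous homomorphism into a group with a subgroup-free neighbourhood of `1` is trivial
on an open subgroup, i.e. has open kernel. -/

variable {G : Type u} [Group G] [TopologicalSpace G] [IsTopologicalGroup G] [CompactSpace G]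
  [TotallyDisconnectedSpace G] {M : Type w} [Group M] [TopologicalSpace M]

/-- a continuous homomorphism from a profinite group into a group with a subgroup-free
neighbourhood of `1` kills an open (normal) subgroup. [folklore] -/
theorem exists_openNormalSubgroup_le_ker {U : Set M} (hU : IsNSSNhd U) (c : G →* M)
    (hc : Continuous c) : ∃ H : OpenNormalSubgroup G, (H : Subgroup G) ≤ c.ker := by
  have h1 : c ⁻¹' U ∈ 𝓝 (1 : G) := by
    apply hc.continuousAt.preimage_mem_nhds
    rw [map_one]
    exact hU.1
  obtain ⟨H, hH⟩ := ProfiniteGrp.exist_openNormalSubgroup_sub_open_nhds_of_one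
    (isOpen_interior (s := c ⁻¹' U)) (mem_interior_iff_mem_nhds.mpr h1)
  refine ⟨H, fun k hk => ?_⟩
  have hbot : ((H : Subgroup G).map c) = ⊥ := by
    apply hU.2
    rintro _ ⟨x, hx, rfl⟩
    exact (interior_subset (s := c ⁻¹' U) (hH hx) : x ∈ c ⁻¹' U)
  rw [MonoidHom.mem_ker]
  have : c k ∈ (H : Subgroup G).map c := ⟨k, hk, rfl⟩
  rw [hbot] at this
  exact Subgroup.mem_bot.mp this

/-- … hence has open kernel. [folklore] -/
theorem isOpen_ker_of_isNSSNhd {U : Set M} (hU : IsNSSNhd U) (c : G →* M) (hc : Continuous c) :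
    IsOpen (c.ker : Set G) := by
  obtain ⟨H, hH⟩ := exists_openNormalSubgroup_le_ker hU c hc
  exact Subgroup.isOpen_mono hH H.isOpen

end Profinite

section Complex

/-- **`ℂˣ` has no small subgroups**: the neighbourhood `‖z - 1‖ < 1/2` of `1` contains no
subgroup but `⊥` (all powers of an element of such a subgroup stay within `1/2` of `1`;
`HeckeCharacter.eq_one_of_norm_pow_sub_one_le`). [folklore] -/
theorem isNSSNhd_units_complex : IsNSSNhd {u : ℂˣ | ‖(u : ℂ) - 1‖ < 2⁻¹} := by
  constructor
  · have hopen : IsOpen {u : ℂˣ | ‖(u : ℂ) - 1‖ < 2⁻¹} :=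
      (isOpen_lt (continuous_norm.comp (Units.continuous_val.sub continuous_const))
        continuous_const)
    exact hopen.mem_nhds (by simp)
  · intro H hH
    rw [Subgroup.eq_bot_iff_forall]
    intro u hu
    have hpow : ∀ n : ℕ, ‖(u : ℂ) ^ n - 1‖ ≤ 2⁻¹ := by
      intro n
      have hn : u ^ n ∈ H := H.pow_mem hu n
      have := hH hn
      simp only [Set.mem_setOf_eq, Units.val_pow_eq_pow_val] at this
      exact this.le
    have h1 : (u : ℂ) = 1 :=
      Literature.NumberTheory.GaloisRepresentations.HeckeCharacter.eq_one_of_norm_pow_sub_one_le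
        (c := 2⁻¹) (by norm_num) hpow
    exact Units.ext h1

variable {ι : Type u} {K : ι → Type v} [∀ i, Group (K i)] [∀ i, TopologicalSpace (K i)]

/-- **A continuous `ℂˣ`-valued character of a product group is trivial on all but finitely many
factors**: there is a finite `S` with `c k = 1` whenever `k i = 1` for all `i ∈ S`. [folklore] -/
theorem exists_finset_forall_apply_eq_one (c : (Π i, K i) →* ℂˣ) (hc : Continuous c) :
    ∃ S : Finset ι, ∀ k : Π i, K i, (∀ i ∈ S, k i = 1) → c k = 1 :=
  exists_finset_forall_apply_eq_one_of_isNSSNhd isNSSNhd_units_complex c hc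

/-- **a continuous `ℂˣ`-valued character of a profinite group has open kernel.** [folklore] -/
theorem isOpen_ker_units_complex {G : Type u} [Group G] [TopologicalSpace G] [IsTopologicalGroup G]
    [CompactSpace G] [TotallyDisconnectedSpace G] (c : G →* ℂˣ) (hc : Continuous c) :
    IsOpen (c.ker : Set G) :=
  isOpen_ker_of_isNSSNhd isNSSNhd_units_complex c hc

/-- pointwise form: an open normal subgroup on which `c` is trivial. [folklore] -/
theorem exists_openNormalSubgroup_forall_eq_one {G : Type u} [Group G] [TopologicalSpace G]
    [IsTopologicalGroup G] [CompactSpace G] [TotallyDisconnectedSpace G] (c : G →* ℂˣ)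
    (hc : Continuous c) : ∃ H : OpenNormalSubgroup G, ∀ k ∈ (H : Subgroup G), c k = 1 := by
  obtain ⟨H, hH⟩ := exists_openNormalSubgroup_le_ker isNSSNhd_units_complex c hc
  exact ⟨H, fun k hk => (MonoidHom.mem_ker).mp (hH hk)⟩

/-- the same for a single factor: outside `S`, `c` kills the whole factor `K i` (embedded by
`Pi.mulSingle`). [folklore] -/
theorem exists_finset_forall_mulSingle_eq_one [DecidableEq ι] (c : (Π i, K i) →* ℂˣ)
    (hc : Continuous c) :
    ∃ S : Finset ι, ∀ i ∉ S, ∀ x : K i, c (Pi.mulSingle i x) = 1 := by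
  obtain ⟨S, hS⟩ := exists_finset_forall_apply_eq_one c hc
  refine ⟨S, fun i hi x => hS _ fun j hj => ?_⟩
  have hji : j ≠ i := fun h => hi (h ▸ hj)
  exact Pi.mulSingle_eq_of_ne hji x

end Complex

section CentralComparison

/-! ### Comparing two lifts through a central kernel

[folklore]  If `s, α : K →* Mp` lift the same homomorphism through `π : Mp →* Sp` and `ker π` is
central, then `k ↦ s k * (α k)⁻¹` is a homomorphism `K →* Mp` with values in `ker π`, and
`s = twistHom · α`.  (With `K = ∏ K_v`, `s` = a compatible splitting of [GelbartRogawski1991,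
Prop. 3.1.1] restricted to `K`, `α` = the lattice-normalised implementers and `ker π = ℂ*`, the
lemmas above apply to `twistHom` read in `ℂˣ`.) -/

variable {K : Type u} {Mp : Type v} {Sp : Type w} [Group K] [Group Mp] [Group Sp]

/-- the quotient `s · α⁻¹` of two lifts of the same homomorphism through a homomorphism `π` with
central kernel, as a homomorphism. [folklore] -/
def twistHom (π : Mp →* Sp) (hker : ∀ m : Mp, π m = 1 → m ∈ Subgroup.center Mp) (s α : K →* Mp)
    (h : ∀ k : K, π (s k) = π (α k)) : K →* Mp where
  toFun k := s k * (α k)⁻¹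
  map_one' := by rw [map_one, map_one, inv_one, mul_one]
  map_mul' x y := by
    have hy : s y * (α y)⁻¹ ∈ Subgroup.center Mp := by
      apply hker
      rw [map_mul, map_inv, h y, mul_inv_cancel]
    rw [Subgroup.mem_center_iff] at hy
    rw [map_mul, map_mul, mul_inv_rev, ← mul_assoc, mul_assoc (s x), mul_assoc (s x), ← hy (α x)⁻¹,
      ← mul_assoc]

/-- `twistHom` is `k ↦ s k · (α k)⁻¹`. [folklore] -/
@[simp] theorem twistHom_apply (π : Mp →* Sp) (hker : ∀ m : Mp, π m = 1 → m ∈ Subgroup.center Mp)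
    (s α : K →* Mp) (h : ∀ k : K, π (s k) = π (α k)) (k : K) :
    twistHom π hker s α h k = s k * (α k)⁻¹ := rfl

/-- `twistHom` takes values in `ker π`. [folklore] -/
theorem map_twistHom (π : Mp →* Sp) (hker : ∀ m : Mp, π m = 1 → m ∈ Subgroup.center Mp)
    (s α : K →* Mp) (h : ∀ k : K, π (s k) = π (α k)) (k : K) :
    π (twistHom π hker s α h k) = 1 := by
  rw [twistHom_apply, map_mul, map_inv, h k, mul_inv_cancel]

/-- `twistHom` takes central values. [folklore] -/
theorem twistHom_mem_center (π : Mp →* Sp) (hker : ∀ m : Mp, π m = 1 → m ∈ Subgroup.center Mp)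
    (s α : K →* Mp) (h : ∀ k : K, π (s k) = π (α k)) (k : K) :
    twistHom π hker s α h k ∈ Subgroup.center Mp :=
  hker _ (map_twistHom π hker s α h k)

/-- `s = twistHom · α`. [folklore] -/
theorem eq_twistHom_mul (π : Mp →* Sp) (hker : ∀ m : Mp, π m = 1 → m ∈ Subgroup.center Mp)
    (s α : K →* Mp) (h : ∀ k : K, π (s k) = π (α k)) (k : K) :
    s k = twistHom π hker s α h k * α k := by
  rw [twistHom_apply, inv_mul_cancel_right]

/-- where the twist is trivial, the two lifts agree. [folklore] -/
theorem eq_of_twistHom_eq_one (π : Mp →* Sp) (hker : ∀ m : Mp, π m = 1 → m ∈ Subgroup.center Mp)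
    (s α : K →* Mp) (h : ∀ k : K, π (s k) = π (α k)) {k : K}
    (hk : twistHom π hker s α h k = 1) : s k = α k := by
  rw [eq_twistHom_mul π hker s α h k, hk, one_mul]

/-- the product `s · ν` of a homomorphism with a CENTRAL-valued homomorphism, as a homomorphism
(the converse direction of the comparison: twisting a lift by a central character gives a lift).
[folklore] -/
def mulCentralHom (s ν : K →* Mp) (hν : ∀ k : K, ν k ∈ Subgroup.center Mp) : K →* Mp where
  toFun k := s k * ν k
  map_one' := by rw [map_one, map_one, mul_one]
  map_mul' x y := by
    have hx := Subgroup.mem_center_iff.mp (hν x)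
    rw [map_mul, map_mul, mul_assoc (s x) (s y), ← mul_assoc (s y), hx (s y), mul_assoc (s x) (ν x),
      ← mul_assoc (ν x) (s y) (ν y)]

/-- `mulCentralHom` is `k ↦ s k · ν k`. [folklore] -/
@[simp] theorem mulCentralHom_apply (s ν : K →* Mp) (hν : ∀ k : K, ν k ∈ Subgroup.center Mp)
    (k : K) : mulCentralHom s ν hν k = s k * ν k := rfl

/-- `π ∘ (s · ν) = π ∘ s` when `π ∘ ν = 1`. [folklore] -/
theorem map_mulCentralHom (π : Mp →* Sp) (s ν : K →* Mp)
    (hν : ∀ k : K, ν k ∈ Subgroup.center Mp) (hπν : ∀ k : K, π (ν k) = 1) (k : K) :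
    π (mulCentralHom s ν hν k) = π (s k) := by
  rw [mulCentralHom_apply, map_mul, hπν k, mul_one]

/-- where `ν` is trivial, `s · ν` agrees with `s` (so `(s · ν)(γ) ∈ i(Sp_F(W))` whenever
`s(γ) ∈ i(Sp_F(W))` and `ν(γ) = 1`: the twist of a compatible splitting by a central character
trivial on `G(F)` is compatible). [folklore] -/
theorem mulCentralHom_apply_of_eq_one (s ν : K →* Mp) (hν : ∀ k : K, ν k ∈ Subgroup.center Mp)
    {k : K} (hk : ν k = 1) : mulCentralHom s ν hν k = s k := by
  rw [mulCentralHom_apply, hk, mul_one]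

end CentralComparison

end Literature.GroupTheory.PiCharacter
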